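import Summits.QuantumFields.YangMills.Theses.ConvexGribovBody
import Literature.MathematicalPhysics.QuantumLattice.GaugeGroups
import Literature.MathematicalPhysics.QuantumLattice.GrassmannIntegral
import Literature.AlgebraicTopology.FundamentalGroup.CircleValuedLift

/-!
# `NonSimplyConnectedLatticeGap` — negative lemma: the non-abelian clause is load-bearing
(modulo weak-coupling masslessness of Wilson `U(1)₄` on tori)

Negative-side support for crux `stmt-QuantumFields-16405`
(`Summit.QuantumFields.YangMills.Theses.ConvexGribovBody.NonSimplyConnectedLatticeGap`), from the
standing disprover's work file `Cruxes/NonSimplyConnectedLatticeGap/Disproof.lean` §A3. The crux's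
group hypothesis is `IsCompactSimpleLieGroup G = (ConnectedSpace G ∧ (∃ a b, a * b ≠ b * a) ∧
∀ N normal closed preconnected, N = ⊥ ∨ N = ⊤) ∧ Nonempty (LatticeRep G)` together with
`¬ SimplyConnectedSpace G`. This file shows, kernel-checked, that `U(1) = Circle` passes EVERY
clause except `∃ a b, a * b ≠ b * a`:

* `circle_subgroup_eq_bot_or_top` — a preconnected subgroup of the circle is `⊥` or `⊤` (the
  closed-connected-normal-subgroup clause; closedness is not even needed);
* `not_simplyConnectedSpace_circle` — `π₁(S¹) ≠ 1` (via the tree's real-lift criterion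
  `AddCircle.not_simplyConnectedSpace_of_lift`);
* `circle_passes_all_but_nonAbelian` — the package, with the faithful unitary `u1Rep`;
* `nonSimplyConnectedLatticeGap_false_without_nonAbelian_of_u1Massless` — HENCE the crux with the
  non-abelian clause deleted (everything else verbatim) is false as soon as Wilson-action `U(1)₄`
  has no volume-uniform torus mass gap at weak coupling (hypothesis `hU`, =
  `Cruxes/…/Disproof.U1WilsonTorusMasslessD4`: the crux body negated at `G = U(1)`, `r = u1Rep`, for
  arbitrarily large `β` — the torus/time-axis form of the Guth–Fröhlich–Spencer Coulomb phase,
  printed for the Villain action (FS82 §2.11), asserted for Wilson's (FS82 p. 433), open as stated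
  like the tree's `Literature.Barriers.QuantumFields.AbelianMasslessPhaseD4`). So non-abelianness is
  the ONLY clause separating the crux from the abelian deconfinement barrier
  (`AbelianDeconfinementD4`, technique class group-blind): any proof must use it.

Nothing here asserts a Theses statement; the last theorem is conditional on `hU` and refutes a
WEAKENING of the crux's hypotheses, not the crux.
-/

noncomputable section

namespace Summit.QuantumFields.YangMills.Theorems.NonSimplyConnectedLatticeGap.Negative

open MeasureTheory Filter Topology Function
open Literature.MathematicalPhysics.QuantumFieldTheory
open Literature.MathematicalPhysics.QuantumLattice (u1Rep continuous_u1Rep u1Rep_injective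
  u1Rep_mem_unitaryGroup)

/-- **`U(1)` satisfies the closed-connected-normal-subgroup clause of `IsSimpleCompactGroup`.**
A preconnected subgroup `N` of the circle is `⊥` or `⊤`: if `1 ≠ w ∈ N` and `z ∉ N`, the chart
`u ↦ arg(−z⁻¹u)` is continuous and injective on `Circle ∖ {z} ⊇ N`, so it maps `N` onto an
interval containing the distinct reals `ψ 1`, `ψ w`; the open arc over the open interval between
them lies in `N`, so `N` is an open subgroup of a connected group, i.e. `N = ⊤` — contradiction.
[folklore] -/
theorem circle_subgroup_eq_bot_or_top (N : Subgroup Circle)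
    (hp : IsPreconnected (N : Set Circle)) : N = ⊥ ∨ N = ⊤ := by
  by_contra hcon
  have hbot : N ≠ ⊥ := fun h => hcon (Or.inl h)
  have htop : N ≠ ⊤ := fun h => hcon (Or.inr h)
  obtain ⟨w, hwN, hw1⟩ : ∃ w ∈ N, w ≠ (1 : Circle) := by
    by_contra h'
    refine hbot ((Subgroup.eq_bot_iff_forall _).2 fun w hw => ?_)
    by_contra hw1
    exact h' ⟨w, hw, hw1⟩
  obtain ⟨z, hzN⟩ : ∃ z : Circle, z ∉ N := by
    by_contra h'
    refine htop ((Subgroup.eq_top_iff' _).2 fun z => ?_)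
    by_contra hz
    exact h' ⟨z, hz⟩
  -- the chart
  let φ : Circle → Circle := fun u => -(z⁻¹ * u)
  let ψ : Circle → ℝ := fun u => Complex.arg ((φ u : Circle) : ℂ)
  have hφ1 : ∀ u : Circle, φ u = -1 ↔ u = z := fun u => by
    show -(z⁻¹ * u) = -1 ↔ u = z
    rw [neg_inj, inv_mul_eq_one, eq_comm]
  have hslit : ∀ u : Circle, u ≠ z → ((φ u : Circle) : ℂ) ∈ Complex.slitPlane := by
    intro u hu
    rw [Complex.mem_slitPlane_iff_arg]
    refine ⟨fun harg => hu ((hφ1 u).1 ?_), Circle.coe_ne_zero _⟩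
    have : Complex.arg ((φ u : Circle) : ℂ) = Complex.arg (((-1 : Circle)) : ℂ) := by
      rw [harg, Circle.coe_neg, Circle.coe_one, Complex.arg_neg_one]
    exact Circle.arg_eq_arg.1 this
  have hφcont : Continuous φ := (continuous_const.mul continuous_id).neg
  have hφc : Continuous fun u : Circle => ((φ u : Circle) : ℂ) :=
    continuous_subtype_val.comp hφcont
  have hψ : ContinuousOn ψ {z}ᶜ := fun u hu => by
    have h1 : ContinuousAt (fun u : Circle => ((φ u : Circle) : ℂ)) u := hφc.continuousAt
    have h2 : ContinuousAt Complex.arg ((φ u : Circle) : ℂ) := Complex.continuousAt_arg (hslit u hu)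
    exact (h2.comp_of_eq h1 rfl).continuousWithinAt
  have hψinj : Injective ψ := fun u v h => by
    have h' : φ u = φ v := Circle.arg_eq_arg.1 h
    have h'' : z⁻¹ * u = z⁻¹ * v := neg_inj.1 h'
    exact mul_left_cancel h''
  have hNsub : (N : Set Circle) ⊆ {z}ᶜ := fun u hu hz => hzN (by
    rw [Set.mem_singleton_iff] at hz; rwa [hz] at hu)
  have hord : Set.OrdConnected (ψ '' (N : Set Circle)) :=
    isPreconnected_iff_ordConnected.1 (hp.image ψ (hψ.mono hNsub))
  have hab : ψ 1 ≠ ψ w := fun h => hw1 (hψinj h).symm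
  obtain ⟨lo, hi, hlohi, hIcc⟩ :
      ∃ lo hi : ℝ, lo < hi ∧ Set.Icc lo hi ⊆ ψ '' (N : Set Circle) := by
    rcases lt_or_gt_of_ne hab with hlt | hlt
    · exact ⟨_, _, hlt, hord.out (Set.mem_image_of_mem ψ N.one_mem) (Set.mem_image_of_mem ψ hwN)⟩
    · exact ⟨_, _, hlt, hord.out (Set.mem_image_of_mem ψ hwN) (Set.mem_image_of_mem ψ N.one_mem)⟩
  -- the open arc over `(lo, hi)` lies in `N`
  set arc : Set Circle := {z}ᶜ ∩ ψ ⁻¹' Set.Ioo lo hi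
  have harc_open : IsOpen arc := hψ.isOpen_inter_preimage isOpen_compl_singleton isOpen_Ioo
  have harc_sub : arc ⊆ (N : Set Circle) := by
    rintro u ⟨-, hu⟩
    obtain ⟨v, hvN, hv⟩ := hIcc (Set.Ioo_subset_Icc_self hu)
    rwa [← hψinj hv]
  have harc_ne : arc.Nonempty := by
    have hmid : (lo + hi) / 2 ∈ Set.Icc lo hi := ⟨by linarith, by linarith⟩
    obtain ⟨v, hvN, hv⟩ := hIcc hmid
    refine ⟨v, hNsub hvN, ?_⟩
    show ψ v ∈ Set.Ioo lo hi
    rw [hv]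
    exact ⟨by linarith, by linarith⟩
  obtain ⟨v, hv⟩ := harc_ne
  have hopen : IsOpen (N : Set Circle) :=
    N.isOpen_of_mem_nhds (Filter.mem_of_superset (harc_open.mem_nhds hv) harc_sub)
  have hclosed : IsClosed (N : Set Circle) := N.isClosed_of_isOpen hopen
  have hclopen : IsClopen (N : Set Circle) := ⟨hclosed, hopen⟩
  have huniv : (N : Set Circle) = Set.univ := hclopen.eq_univ ⟨1, N.one_mem⟩
  exact htop (Subgroup.coe_eq_univ.1 huniv)

/-- **`U(1)` is not simply connected** (`π₁(S¹) = ℤ`): the loop `t ↦ e^{2πit}` has the real lift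
`t ↦ 2πt` of its `ℝ/2πℤ`-valued coordinate, which does not close up (tree:
`AddCircle.not_simplyConnectedSpace_of_lift`, Hatcher Prop. 1.30 / Thm. 1.7). [cite: HatcherAT2002, Thm. 1.7] -/
theorem not_simplyConnectedSpace_circle : ¬ SimplyConnectedSpace Circle := by
  let g : C(Circle, AddCircle (2 * Real.pi)) :=
    ⟨AddCircle.homeomorphCircle'.symm, AddCircle.homeomorphCircle'.symm.continuous⟩
  let γ : Path (1 : Circle) 1 :=
    { toFun := fun t => Circle.exp (2 * Real.pi * t)
      continuous_toFun := Circle.exp.continuous.comp (continuous_const.mul continuous_subtype_val)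
      source' := by simp
      target' := by simp }
  refine Literature.AlgebraicTopology.FundamentalGroup.AddCircle.not_simplyConnectedSpace_of_lift
    g γ (G := fun t => 2 * Real.pi * t) (continuous_const.mul continuous_subtype_val)
    (fun t => ?_) ?_
  · show ((2 * Real.pi * t : ℝ) : AddCircle (2 * Real.pi)) =
      AddCircle.homeomorphCircle'.symm (Circle.exp (2 * Real.pi * t))
    exact ((AddCircle.homeomorphCircle'.symm_apply_eq).2
      (AddCircle.homeomorphCircle'_apply_mk _).symm).symm
  · show (2 * Real.pi * (1 : ℝ)) ≠ 2 * Real.pi * (0 : ℝ)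
    simp [Real.pi_ne_zero]

/-- **The crux's hypotheses at `U(1)`**: `Circle` (Borel σ-algebra `Circle.instMeasurableSpace`)
passes every clause of `IsCompactSimpleLieGroup` except `∃ a b, a * b ≠ b * a`, passes
`¬ SimplyConnectedSpace`, and carries the faithful continuous unitary lattice representation
`u1Rep` (charge one). [folklore] -/
theorem circle_passes_all_but_nonAbelian :
    ConnectedSpace Circle ∧
      (∀ N : Subgroup Circle, N.Normal → IsClosed (N : Set Circle) →
        IsPreconnected (N : Set Circle) → N = ⊥ ∨ N = ⊤) ∧
      Nonempty (LatticeRep Circle) ∧ ¬ SimplyConnectedSpace Circle ∧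
      ¬ (∃ a b : Circle, a * b ≠ b * a) :=
  ⟨inferInstance, fun N _ _ hp => circle_subgroup_eq_bot_or_top N hp,
    ⟨⟨1, u1Rep, continuous_u1Rep, u1Rep_injective, u1Rep_mem_unitaryGroup⟩⟩,
    not_simplyConnectedSpace_circle, fun ⟨a, b, h⟩ => h (mul_comm a b)⟩

/-- **The non-abelian clause of `NonSimplyConnectedLatticeGap` is load-bearing, modulo weak-coupling
masslessness of Wilson `U(1)₄` on tori.** Hypothesis `hU` (`U1WilsonTorusMasslessD4` of the
disprover's work file): for every `β₀` there is `β ≥ β₀` at which the crux's clustering body fails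
for `G = U(1)`, `r = u1Rep` (no rate `m > 0`, threshold `S₁` and constants `C(A,B)` with
`|corr_S(A,B,n)| ≤ C e^{-mn}` for all gauge-invariant local `A, B`, `S ≥ S₁`, `n ≤ S`) — the torus
form of the Coulomb phase of compact `U(1)₄` (Guth 1980; Fröhlich–Spencer 1982 §2.11, Villain action;
Wilson action asserted ibid. p. 433; open as stated). CONCLUSION: the crux with
`∃ a b, a * b ≠ b * a` deleted from `IsSimpleCompactGroup` and everything else verbatim is false —
instantiate at `U(1)` (`circle_passes_all_but_nonAbelian`).
[cite: FrohlichSpencerCMP1982, §2.11 pp. 433–437 (Villain); Wilson asserted p. 433]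
[cite: MontvayMunster1994, §3.7.1 item 4.1 (PDF p. 164)] -/
theorem nonSimplyConnectedLatticeGap_false_without_nonAbelian_of_u1Massless
    (hU : ∀ β₀ : ℝ, ∃ β : ℝ, β₀ ≤ β ∧ ¬ (∃ m : ℝ, 0 < m ∧ ∃ S₁ : ℕ, ∀ A B : YMSpecies Circle,
      ∃ C : ℝ, ∀ S n : ℕ, S₁ ≤ S → n ≤ S →
      |latticeConnectedCorr u1Rep β (2 * S + 1) A.F B.F n| ≤ C * Real.exp (-(m * n)))) :
    ¬ (∀ (G : Type) [Group G] [TopologicalSpace G] [IsTopologicalGroup G] [CompactSpace G]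
      [MeasurableSpace G] [BorelSpace G],
      (ConnectedSpace G ∧ (∀ N : Subgroup G, N.Normal → IsClosed (N : Set G) →
          IsPreconnected (N : Set G) → N = ⊥ ∨ N = ⊤) ∧ Nonempty (LatticeRep G)) →
      ¬ SimplyConnectedSpace G →
      ∀ r : LatticeRep G, ∃ β₀ : ℝ, ∀ β : ℝ, β₀ ≤ β → ∃ m : ℝ, 0 < m ∧ ∃ S₁ : ℕ,
      ∀ A B : YMSpecies G, ∃ C : ℝ, ∀ S n : ℕ, S₁ ≤ S → n ≤ S →
      |latticeConnectedCorr r.ρ β (2 * S + 1) A.F B.F n| ≤ C * Real.exp (-(m * n))) := by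
  intro h
  obtain ⟨hc, hs, hne, hnsc, -⟩ := circle_passes_all_but_nonAbelian
  obtain ⟨β₀, hβ₀⟩ := h Circle ⟨hc, hs, hne⟩ hnsc
    ⟨1, u1Rep, continuous_u1Rep, u1Rep_injective, u1Rep_mem_unitaryGroup⟩
  obtain ⟨β, hb, hno⟩ := hU β₀
  exact hno (hβ₀ β hb)

end Summit.QuantumFields.YangMills.Theorems.NonSimplyConnectedLatticeGap.Negative

end
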